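import Summits.Schanuel.Schanuel.Theorems.RootDecomp1KCommonRadixCell03

/-!
# RootDecomp1KCommonRadixCell — lens 1, generation 37 «COMMON-RADIX WALL CELL of 33364» (the dependent-base wall `(1, ℓ₂, ℓ₄)`) — continuation (RootDecomp1KCommonRadixCell04): §5 the equivalence `truncGeneric_iff_algebraicIndependent`, (CR) `algebraicIndependent_liouvilleNumber_commonRadix` and (X″) `algebraicIndependent_append_of_block`; §6 suppliers: `sb_liouvilleBlockCell (hNW)`, `sb_commonRadixCell (hNW)`, `sb_wallCell24 (hNW)`, the π-twins hypothesis-free, `a12`, `a123`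

(lens-1 g37 `RootDecomp1KCommonRadixCell.lean`, sha256 2ee3a3e8…2418, own farm rc 0 · 0 sorry · axioms std; critic VERDICT STATUS L1748
(credit K-R23 (β′), PORT GO LOW); port by census-1 gen 16 in seven parts `RootDecomp1KCommonRadixCell01`–`07` — see the PORT NOTE of part 01;
`--supports stmt-Schanuel-33364`; rung 0.)
-/

noncomputable section

open Complex IntermediateField Polynomial
open Summit.Schanuel.Schanuel.Theorems.RootDecomp1KHyper
open Summit.Schanuel.Schanuel.Theorems.RootDecomp1KHyper.HyperCell
open Summit.Schanuel.Schanuel.Theorems.RootDecomp1KGeneric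
open Summit.Schanuel.Schanuel.Theorems.RootDecomp1KRelLiouvilleCell
open Summit.Schanuel.Schanuel.Theorems.RootDecomp1KLogLogCell (LogLogLiouville logLogLiouville_of_logSqLiouville
  logLogLiouville_of_logHyperLiouville logLogLiouville_of_hyperLiouville)
open Summit.Schanuel.Schanuel.Theorems.RootDecomp1KTwoBaseCell (partialSum_pos' liouvilleNumber_le partialSum_lt_two numerator_lt exists_int_mul_eq_map' algebraicIndependent_of_forall_int' norm_pow_sub_pow_le' norm_prod_pow_sub_prod_pow_le norm_aeval_sub_aeval_le growth_beats lpart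
  tpart lpart_apply tpart_apply eq_of_parts_eq psNumer partialSum_eq_psNumer_div coprime_psNumer liouvilleNumber_sub_rat_lower_loglog not_logLogLiouville_liouvilleNumber liouvilleNumber_three_lt_one sb_of_range_eq')

namespace Summit.Schanuel.Schanuel.Theorems.RootDecomp1KCommonRadixCell

open LiouvilleNumber
open scoped Nat

section Equivalence
open LiouvilleNumber
open scoped Nat

variable {k n : ℕ}

/-- From an «eventually, for every real polynomial» statement (g36 (L), this file's (CR)) to `TruncGeneric`. -/
theorem truncGeneric_of_eventually {b : Fin k → ℕ}
    (h : ∀ q : MvPolynomial (Fin k) ℝ, q ≠ 0 →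
      ∃ N₀ : ℕ, ∀ N, N₀ ≤ N → MvPolynomial.eval (fun i => partialSum (b i : ℝ) N) q ≠ 0) :
    TruncGeneric b := by
  intro qZ hqZ N₁
  have hq0 : MvPolynomial.map (Int.castRingHom ℝ) qZ ≠ 0 := fun h0 =>
    hqZ (MvPolynomial.map_injective _ Int.cast_injective (by rw [h0, map_zero]))
  obtain ⟨N₀, hN₀⟩ := h _ hq0
  refine ⟨max N₀ N₁, le_max_right _ _, ?_⟩
  rw [MvPolynomial.aeval_def, algebraMap_int_eq, ← MvPolynomial.eval_map]
  exact hN₀ _ (le_max_left _ _)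

/-- **The common-radix base vectors `(β^{a_1}, …, β^{a_k})` are truncation-generic** (from (CR)). -/
theorem truncGeneric_commonRadix {β : ℕ} (hβ : 2 ≤ β) {a : Fin k → ℕ} (ha : Function.Injective a)
    (ha1 : ∀ i, 1 ≤ a i) : TruncGeneric (fun i => β ^ a i) :=
  truncGeneric_of_eventually fun _ hq => eventually_eval_partialSum_ne_zero_commonRadix hβ ha ha1 hq

/-- Complexification of an integer-polynomial value. -/
theorem aeval_ofReal_comp {σ : Type*} (x : σ → ℝ) (q : MvPolynomial σ ℤ) :
    MvPolynomial.aeval (fun i => ((x i : ℝ) : ℂ)) q = ((MvPolynomial.aeval x q : ℝ) : ℂ) := by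
  have h1 : ((MvPolynomial.aeval x q : ℝ) : ℂ) =
      Complex.ofRealHom (MvPolynomial.eval₂ (algebraMap ℤ ℝ) x q) := rfl
  rw [h1, MvPolynomial.eval₂_comp_left, MvPolynomial.aeval_def]
  congr 1

/-- **Trivial direction:** an algebraically independent Liouville block is truncation-generic (continuity of
polynomials: if `q(s_N) = 0` for all large `N` then `q(ℓ) = 0`). -/
theorem truncGeneric_of_algebraicIndependent {b : Fin k → ℕ} (hb : ∀ i, 2 ≤ b i)
    (hAI : AlgebraicIndependent ℚ (fun i => ((liouvilleNumber (b i) : ℝ) : ℂ))) : TruncGeneric b := by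
  intro q hq N₀
  by_contra hcon'
  have hcon : ∀ N, N₀ ≤ N → MvPolynomial.aeval (fun i => partialSum (b i : ℝ) N) q = 0 := by
    intro N hN
    by_contra h1
    exact hcon' ⟨N, hN, h1⟩
  have hb1 : ∀ i, (1 : ℝ) < b i := fun i => by exact_mod_cast (by have := hb i; omega : 1 < b i)
  set ℓ : Fin k → ℝ := fun i => liouvilleNumber (b i) with hℓ
  -- (1) `q(ℓ) = 0` by continuity
  set qR : MvPolynomial (Fin k) ℝ := MvPolynomial.map (Int.castRingHom ℝ) q with hqR
  have hev : ∀ x : Fin k → ℝ, MvPolynomial.aeval x q = MvPolynomial.eval x qR := fun x => by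
    rw [MvPolynomial.aeval_def, algebraMap_int_eq, ← MvPolynomial.eval_map]
  have hlim : Filter.Tendsto (fun N : ℕ => (fun i => partialSum (b i : ℝ) N)) Filter.atTop (nhds ℓ) :=
    tendsto_pi_nhds.mpr fun i => tendsto_partialSum (hb1 i)
  have hcont : Continuous fun x : Fin k → ℝ => MvPolynomial.eval x qR := MvPolynomial.continuous_eval qR
  have hT := (hcont.tendsto ℓ).comp hlim
  have hT0 : Filter.Tendsto ((fun x : Fin k → ℝ => MvPolynomial.eval x qR) ∘
      fun N : ℕ => (fun i => partialSum (b i : ℝ) N)) Filter.atTop (nhds 0) := by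
    refine tendsto_const_nhds.congr' ?_
    rw [Filter.EventuallyEq, Filter.eventually_atTop]
    exact ⟨N₀, fun N hN => by simp only [Function.comp]; rw [← hev]; exact (hcon N hN).symm⟩
  have hℓ0 : MvPolynomial.eval ℓ qR = 0 := tendsto_nhds_unique hT hT0
  -- (2) complexify and contradict algebraic independence
  have hC : MvPolynomial.aeval (fun i => ((ℓ i : ℝ) : ℂ)) q = 0 := by
    rw [aeval_ofReal_comp, hev, hℓ0, Complex.ofReal_zero]
  have hQ : MvPolynomial.aeval (fun i => ((ℓ i : ℝ) : ℂ)) (MvPolynomial.map (Int.castRingHom ℚ) q) = 0 := by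
    rw [show Int.castRingHom ℚ = algebraMap ℤ ℚ from rfl, MvPolynomial.aeval_map_algebraMap]; exact hC
  have h0 := (algebraicIndependent_iff.mp hAI) _ hQ
  exact hq (MvPolynomial.map_injective _ Int.cast_injective (by rw [h0, map_zero]))

/-- The empty tuple is (vacuously) measured: `MvPolyMeasure (θ : Fin 0 → ℂ)` with `C = 1`, `τ = 0`. -/
theorem mvPolyMeasure_fin0 (θ : Fin 0 → ℂ) : MvPolyMeasure θ := by
  intro d
  refine ⟨1, 0, one_pos, fun P hP _ => ?_⟩
  obtain ⟨c, rfl⟩ : ∃ c : ℤ, P = MvPolynomial.C c := ⟨_, MvPolynomial.eq_C_of_isEmpty P⟩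
  have hc : c ≠ 0 := fun h => hP (by rw [h, MvPolynomial.C_0])
  rw [pow_zero, one_mul, one_mul, MvPolynomial.aeval_C, algebraMap_int_eq, eq_intCast, Complex.norm_intCast]
  exact_mod_cast Int.one_le_abs hc

/-- **Non-trivial direction:** a truncation-generic Liouville block is algebraically independent (the engine at
`n = 0`). -/
theorem algebraicIndependent_of_truncGeneric {b : Fin k → ℕ} (hb : ∀ i, 2 ≤ b i) (hnv : TruncGeneric b) :
    AlgebraicIndependent ℚ (fun i => ((liouvilleNumber (b i) : ℝ) : ℂ)) := by
  have h := (algebraicIndependent_liouville_of_truncGeneric hb hnv (mvPolyMeasure_fin0 (fun _ => 0))).comp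
    _ Sum.inl_injective
  exact h

/-- **`TruncGeneric b ⟺ AlgebraicIndependent ℚ (ℓ_{b_1}, …, ℓ_{b_k})`** — the abstraction is EXACTLY the algebraic
independence of the Liouville block (so (X″) below is best possible in its hypothesis on the block). -/
theorem truncGeneric_iff_algebraicIndependent {b : Fin k → ℕ} (hb : ∀ i, 2 ≤ b i) :
    TruncGeneric b ↔ AlgebraicIndependent ℚ (fun i => ((liouvilleNumber (b i) : ℝ) : ℂ)) :=
  ⟨algebraicIndependent_of_truncGeneric hb, truncGeneric_of_algebraicIndependent hb⟩

/-- `Sum.elim u v ∘ finSumFinEquiv⁻¹ = Fin.append u v` (g36, verbatim). -/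
private theorem sumElim_comp_finSumFinEquiv_symm {α : Type*} (u : Fin k → α) (v : Fin n → α) :
    Sum.elim u v ∘ finSumFinEquiv.symm = Fin.append u v := by
  funext x
  refine Fin.addCases (fun i => ?_) (fun j => ?_) x
  · simp [finSumFinEquiv_symm_apply_castAdd, Fin.append_left]
  · simp [finSumFinEquiv_symm_apply_natAdd, Fin.append_right]

/-- **(X″) THE JOIN THEOREM.** A measured tuple `θ` (`MvPolyMeasure θ`, tree FQ
`Summit.Schanuel.Schanuel.Theorems.RootDecomp1KHyper.MvPolyMeasure`) is algebraically independent from EVERY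
algebraically independent block of standard Liouville numbers `(ℓ_{b_1}, …, ℓ_{b_k})`, `b_i ≥ 2`:
`AlgebraicIndependent ℚ (ℓ_{b_1}, …, ℓ_{b_k}, θ_1, …, θ_n)`.  No condition on the bases beyond the independence of
the block itself (which is necessary). -/
theorem algebraicIndependent_append_of_algebraicIndependent {b : Fin k → ℕ} {θ : Fin n → ℂ}
    (hθ : Summit.Schanuel.Schanuel.Theorems.RootDecomp1KHyper.MvPolyMeasure θ) (hb : ∀ i, 2 ≤ b i)
    (hAI : AlgebraicIndependent ℚ (fun i => ((liouvilleNumber (b i) : ℝ) : ℂ))) :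
    AlgebraicIndependent ℚ (Fin.append (fun i => ((liouvilleNumber (b i) : ℝ) : ℂ)) θ) := by
  rw [← sumElim_comp_finSumFinEquiv_symm]
  exact (algebraicIndependent_liouville_of_truncGeneric hb (truncGeneric_of_algebraicIndependent hb hAI)
    hθ).comp _ finSumFinEquiv.symm.injective

/-- **ALGEBRAIC INDEPENDENCE OF THE COMMON-RADIX LIOUVILLE NUMBERS — HYPOTHESIS-FREE:**
`ℓ_{β^{a_1}}, …, ℓ_{β^{a_k}}` (`β ≥ 2`, `a` injective, `a_i ≥ 1`) are algebraically independent over `ℚ`; in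
particular `ℓ₂` and `ℓ₄` are. -/
theorem algebraicIndependent_liouville_commonRadix {β : ℕ} (hβ : 2 ≤ β) {a : Fin k → ℕ}
    (ha : Function.Injective a) (ha1 : ∀ i, 1 ≤ a i) :
    AlgebraicIndependent ℚ (fun i => ((liouvilleNumber ((β ^ a i : ℕ) : ℝ) : ℝ) : ℂ)) :=
  algebraicIndependent_of_truncGeneric (b := fun i => β ^ a i)
    (fun i => le_trans hβ (Nat.le_self_pow (by have := ha1 i; omega) β)) (truncGeneric_commonRadix hβ ha ha1)

/-- … jointly with any measured tuple: `AlgebraicIndependent ℚ (ℓ_{β^{a_1}}, …, ℓ_{β^{a_k}}, θ)`. -/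
theorem algebraicIndependent_commonRadix_append {β : ℕ} (hβ : 2 ≤ β) {a : Fin k → ℕ}
    (ha : Function.Injective a) (ha1 : ∀ i, 1 ≤ a i) {θ : Fin n → ℂ}
    (hθ : Summit.Schanuel.Schanuel.Theorems.RootDecomp1KHyper.MvPolyMeasure θ) :
    AlgebraicIndependent ℚ (Fin.append (fun i => ((liouvilleNumber ((β ^ a i : ℕ) : ℝ) : ℝ) : ℂ)) θ) :=
  algebraicIndependent_append_of_algebraicIndependent (b := fun i => β ^ a i) hθ
    (fun i => le_trans hβ (Nat.le_self_pow (by have := ha1 i; omega) β))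
    (algebraicIndependent_liouville_commonRadix hβ ha ha1)

end Equivalence

/-! ## §6  Suppliers: Schanuel's bound on the Liouville-block cells, the common-radix cells and the wall `(1, ℓ₂, ℓ₄)` -/

section Suppliers
open LiouvilleNumber
open scoped Nat

variable {k n : ℕ}

/-- `β^{a} ≥ 2` for `β ≥ 2`, `a ≥ 1`. -/
theorem two_le_pow_of_le {β : ℕ} (hβ : 2 ≤ β) {a : Fin k → ℕ} (ha1 : ∀ i, 1 ≤ a i) (i : Fin k) :
    2 ≤ β ^ a i :=
  le_trans hβ (Nat.le_self_pow (by have := ha1 i; omega) β)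

/-- **Schanuel's bound on the LIOUVILLE-BLOCK CELL `(1, ℓ_{b_1}, …, ℓ_{b_k})`, e-version** (mod `hNW : NWMeasure` BY
NAME): for ANY bases `b_i ≥ 2` whose block `(ℓ_{b_i})` is algebraically independent. -/
theorem sb_liouvilleBlockCell (hNW : NWMeasure) {b : Fin k → ℕ} (hb : ∀ i, 2 ≤ b i)
    (hAI : AlgebraicIndependent ℚ (fun i => ((liouvilleNumber (b i) : ℝ) : ℂ))) :
    SB (k + 1) (Fin.cons (1 : ℂ) (fun i => ((liouvilleNumber (b i) : ℝ) : ℂ))) := by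
  have hai := algebraicIndependent_liouville_of_truncGeneric hb (truncGeneric_of_algebraicIndependent hb hAI)
    (mvPolyMeasure_one_of_polyMeasure (polyMeasure_exp_one_of_NW hNW))
  refine sb_of_algebraicIndependent hai (by simp) ?_
  intro x
  rcases x with i | j
  · simp only [Sum.elim_inl]
    exact subset_adjoin ℚ _ (Or.inl (Or.inl ⟨i.succ, by simp⟩))
  · simp only [Sum.elim_inr]
    refine subset_adjoin ℚ _ (Or.inl (Or.inr ⟨0, ?_⟩))
    fin_cases j
    simp

/-- **Schanuel's bound on the LIOUVILLE-BLOCK CELL, π-version `(π, πℓ_{b_1}, …, πℓ_{b_k})` — HYPOTHESIS-FREE given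
the independence of the block** (`θ = π`, tree-proved `polyMeasure_pi`). -/
theorem sb_liouvilleBlockCell_pi {b : Fin k → ℕ} (hb : ∀ i, 2 ≤ b i)
    (hAI : AlgebraicIndependent ℚ (fun i => ((liouvilleNumber (b i) : ℝ) : ℂ))) :
    SB (k + 1) (Fin.cons (Real.pi : ℂ) (fun i => (Real.pi : ℂ) * ((liouvilleNumber (b i) : ℝ) : ℂ))) := by
  set z : Fin (k + 1) → ℂ :=
    Fin.cons (Real.pi : ℂ) (fun i => (Real.pi : ℂ) * ((liouvilleNumber (b i) : ℝ) : ℂ)) with hz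
  have hπ0 : (Real.pi : ℂ) ≠ 0 := by exact_mod_cast Real.pi_ne_zero
  have hz0 : z 0 ∈ adjoin ℚ (SFset z ∪ {I}) := subset_adjoin ℚ _ (Or.inl (Or.inl ⟨0, rfl⟩))
  have hzs : ∀ i : Fin k, z i.succ ∈ adjoin ℚ (SFset z ∪ {I}) := fun i =>
    subset_adjoin ℚ _ (Or.inl (Or.inl ⟨i.succ, rfl⟩))
  have ez0 : z 0 = (Real.pi : ℂ) := by simp [hz]
  have ezs : ∀ i : Fin k, z i.succ = (Real.pi : ℂ) * ((liouvilleNumber (b i) : ℝ) : ℂ) := fun i => by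
    simp [hz]
  have hai := algebraicIndependent_liouville_of_truncGeneric hb (truncGeneric_of_algebraicIndependent hb hAI)
    (mvPolyMeasure_one_of_polyMeasure polyMeasure_pi)
  refine sb_of_algebraicIndependent hai (by simp) ?_
  intro x
  rcases x with i | j
  · simp only [Sum.elim_inl]
    have e : ((liouvilleNumber (b i) : ℝ) : ℂ) = z i.succ / z 0 := by
      rw [ezs, ez0, mul_div_cancel_left₀ _ hπ0]
    rw [e]; exact div_mem (hzs i) hz0
  · simp only [Sum.elim_inr]
    have e : (![(Real.pi : ℂ)] : Fin 1 → ℂ) j = z 0 := by fin_cases j; simp [ez0]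
    rw [e]; exact hz0

/-- **Schanuel's bound on every COMMON-RADIX CELL `(1, ℓ_{β^{a_1}}, …, ℓ_{β^{a_k}})`** (mod `hNW` only). -/
theorem sb_commonRadixCell (hNW : NWMeasure) {β : ℕ} (hβ : 2 ≤ β) {a : Fin k → ℕ}
    (ha : Function.Injective a) (ha1 : ∀ i, 1 ≤ a i) :
    SB (k + 1) (Fin.cons (1 : ℂ) (fun i => ((liouvilleNumber ((β ^ a i : ℕ) : ℝ) : ℝ) : ℂ))) :=
  sb_liouvilleBlockCell hNW (b := fun i => β ^ a i) (two_le_pow_of_le hβ ha1)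
    (algebraicIndependent_liouville_commonRadix hβ ha ha1)

/-- **Schanuel's bound on every COMMON-RADIX CELL, π-version — HYPOTHESIS-FREE.** -/
theorem sb_commonRadixCell_pi {β : ℕ} (hβ : 2 ≤ β) {a : Fin k → ℕ} (ha : Function.Injective a)
    (ha1 : ∀ i, 1 ≤ a i) :
    SB (k + 1) (Fin.cons (Real.pi : ℂ)
      (fun i => (Real.pi : ℂ) * ((liouvilleNumber ((β ^ a i : ℕ) : ℝ) : ℝ) : ℂ))) :=
  sb_liouvilleBlockCell_pi (b := fun i => β ^ a i) (two_le_pow_of_le hβ ha1)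
    (algebraicIndependent_liouville_commonRadix hβ ha ha1)

/-- The wall exponents `a = (1, 2)` (bases `(2, 4) = (2¹, 2²)`). -/
def a12 : Fin 2 → ℕ := ![1, 2]

/-- `a12 = (1, 2)` is injective. -/
theorem a12_injective : Function.Injective a12 := by decide

/-- `a12 ≥ 1`. -/
theorem one_le_a12 : ∀ i, 1 ≤ a12 i := by decide

/-- The `k = 3` exponents `a = (1, 2, 3)` (bases `(2, 4, 8)`). -/
def a123 : Fin 3 → ℕ := ![1, 2, 3]

/-- `a123 = (1, 2, 3)` is injective. -/
theorem a123_injective : Function.Injective a123 := by decide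

/-- `a123 ≥ 1`. -/
theorem one_le_a123 : ∀ i, 1 ≤ a123 i := by decide

/-- **`ℓ₂` and `ℓ₄` are algebraically independent over `ℚ` — HYPOTHESIS-FREE** (the multiplicatively dependent pair). -/
theorem algebraicIndependent_liouville_two_four :
    AlgebraicIndependent ℚ ![((liouvilleNumber 2 : ℝ) : ℂ), ((liouvilleNumber 4 : ℝ) : ℂ)] := by
  have e : (fun i => ((liouvilleNumber ((2 ^ a12 i : ℕ) : ℝ) : ℝ) : ℂ)) =
      ![((liouvilleNumber 2 : ℝ) : ℂ), ((liouvilleNumber 4 : ℝ) : ℂ)] := by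
    funext i; fin_cases i <;> norm_num [a12]
  rw [← e]
  exact algebraicIndependent_liouville_commonRadix (le_refl 2) a12_injective one_le_a12

/-- **Schanuel's bound on the DEPENDENT-BASE WALL CELL `(1, ℓ₂, ℓ₄)`** (mod `hNW` only). -/
theorem sb_wallCell24 (hNW : NWMeasure) :
    SB 3 ![(1 : ℂ), ((liouvilleNumber 2 : ℝ) : ℂ), ((liouvilleNumber 4 : ℝ) : ℂ)] := by
  have e : (Fin.cons (1 : ℂ) (fun i => ((liouvilleNumber ((2 ^ a12 i : ℕ) : ℝ) : ℝ) : ℂ)) : Fin 3 → ℂ) =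
      ![(1 : ℂ), ((liouvilleNumber 2 : ℝ) : ℂ), ((liouvilleNumber 4 : ℝ) : ℂ)] := by
    funext i
    refine Fin.cases ?_ (fun j => ?_) i
    · simp
    · simp only [Fin.cons_succ, Matrix.cons_val_succ]
      fin_cases j <;> norm_num [a12]
  have h := sb_commonRadixCell hNW (le_refl 2) a12_injective one_le_a12
  rw [e] at h
  exact h

/-- **Schanuel's bound on the π-twin `(π, πℓ₂, πℓ₄)` — HYPOTHESIS-FREE.** -/
theorem sb_wallCell24_pi :
    SB 3 ![(Real.pi : ℂ), (Real.pi : ℂ) * ((liouvilleNumber 2 : ℝ) : ℂ),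
      (Real.pi : ℂ) * ((liouvilleNumber 4 : ℝ) : ℂ)] := by
  have e : (Fin.cons (Real.pi : ℂ)
      (fun i => (Real.pi : ℂ) * ((liouvilleNumber ((2 ^ a12 i : ℕ) : ℝ) : ℝ) : ℂ)) : Fin 3 → ℂ) =
      ![(Real.pi : ℂ), (Real.pi : ℂ) * ((liouvilleNumber 2 : ℝ) : ℂ),
        (Real.pi : ℂ) * ((liouvilleNumber 4 : ℝ) : ℂ)] := by
    funext i
    refine Fin.cases ?_ (fun j => ?_) i
    · simp
    · simp only [Fin.cons_succ, Matrix.cons_val_succ]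
      fin_cases j <;> norm_num [a12]
  have h := sb_commonRadixCell_pi (le_refl 2) a12_injective one_le_a12
  rw [e] at h
  exact h

/-- **Schanuel's bound on the COMMON-RADIX cell `(π, πℓ₂, πℓ₄, πℓ₈)` — HYPOTHESIS-FREE** (a `k = 3` instance). -/
theorem sb_cell248_pi :
    SB 4 ![(Real.pi : ℂ), (Real.pi : ℂ) * ((liouvilleNumber 2 : ℝ) : ℂ),
      (Real.pi : ℂ) * ((liouvilleNumber 4 : ℝ) : ℂ), (Real.pi : ℂ) * ((liouvilleNumber 8 : ℝ) : ℂ)] := by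
  have e : (Fin.cons (Real.pi : ℂ)
      (fun i => (Real.pi : ℂ) * ((liouvilleNumber ((2 ^ a123 i : ℕ) : ℝ) : ℝ) : ℂ)) : Fin 4 → ℂ) =
      ![(Real.pi : ℂ), (Real.pi : ℂ) * ((liouvilleNumber 2 : ℝ) : ℂ),
        (Real.pi : ℂ) * ((liouvilleNumber 4 : ℝ) : ℂ), (Real.pi : ℂ) * ((liouvilleNumber 8 : ℝ) : ℂ)] := by
    funext i
    refine Fin.cases ?_ (fun j => ?_) i
    · simp
    · simp only [Fin.cons_succ, Matrix.cons_val_succ]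
      fin_cases j <;> norm_num [a123]
  have h := sb_commonRadixCell_pi (le_refl 2) a123_injective one_le_a123
  rw [e] at h
  exact h

end Suppliers

end Summit.Schanuel.Schanuel.Theorems.RootDecomp1KCommonRadixCell

end
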